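import Mathlib
import Summits.Ventures.PercRepro2.SwOutShadowMultiRootJunctions
import Summits.Ventures.PercRepro2.SwAllMarkStepMultiRoot

/-!
# THE GENERAL MARK STEP WITH ANY SET OF JUNCTIONS, THE ESCAPES IN EITHER COLOUR (blind cell
PercRepro2, night-4 g35, 2026-08-29; proofs/NIGHT4-G35.md §5)

g34's mark step with junctions needed (★): no junction escapes in blue.  The fibration by the
escaping set with the decorated cubes drops (★): **`gTypedSwAll_of_junctions_deco`** — g7's general
doubly typed row on every graph with a set `J` of junctions (no loop at `h` or at a junction, every
other vertex exempt, in `X`, joined to `l`, or isolated) whose side points carry pure, disjoint,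
attached, clustered, stray-free units inside the region with every escaping junction routed to
`l` — and **THE MARK STEP `swAll_markStep_of_junctions_deco`**: row 2′SW-ALL with the mark `x` on
every graph whose vertices other than `l, h, x` are joined to `l`, hang on the mark, or form a set
`J` of junctions, under those canonical conditions on every pattern of the mark's edges.  The
junctions need NOT be adjacent to the mark nor to `h`: this is the BLUE-ESCAPING junction of
g34's frontier (NIGHT4-G34.md §7–§9), its escape paired with the red one by the decorated cube.
The conditions are the census's: mining/night-4/g35/shadow12.py.
-/

namespace Summit.Ventures.PercRepro2

namespace LocRows

open Hull

universe u v

variable {V : Type u} {E : Type v} [Fintype E] [DecidableEq E]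

open scoped Classical

variable {ends : E → Sym2 V} {l h : V} {𝓤 𝓓 𝓓'' : Set (Set V)} {X : Set V} {𝓤' : Set (Set V)}
  {F : V → Prop}

/-- The canonical conditions of the decorated cubes at a side point with the roots `R`, the
escaping set `T`. -/
def DecoCanonical (ends : E → Sym2 V) (R : Set V) (l : V) (U : Set V) (T : Set V) (ζ : Config E) :
    Prop :=
  Pure ends R l ζ ∧ UnitsDisjoint ends R l ζ ∧ Attached ends R l ζ ∧
    Clustered ends R l ζ ∧ NoStray ends R l ζ ∧ (∀ u ∈ unitsR ends R l ζ, u ⊆ U) ∧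
    (∀ u ∈ T, ∃ v ∈ unitsR ends R l ζ, u ∈ cluster ends (decoRoute ends v (baseDeco ends R l ζ)) l)

section Graph

/-- **THE MULTI-JUNCTION CLASS FROM THE DECORATED CUBES ON THE GRAPH**: the general doubly typed
row on every graph with the junctions `J` in `{l}ᶜ`, under the canonical conditions on every
fibre of every class. -/
theorem gTypedSwAll_of_junctions_deco {J : Finset V} (hlh : l ≠ h)
    (hloop : ∀ e r, r ∈ insert h (↑J : Set V) → ends e ≠ s(r, r))
    (h𝓤 : IsUpperSet 𝓤) (h𝓓 : IsLowerSet 𝓓) (h𝓓'' : IsLowerSet 𝓓'') (h𝓤' : IsUpperSet 𝓤')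
    (hF : ∀ x, F x → ∀ S ∈ 𝓤, x ∈ S) (hhX : h ∉ X) (hJX : ∀ u ∈ J, u ∉ X)
    (hX : ∀ x ∈ X, x ≠ l → ∀ e, x ∈ ends e → ends e = s(x, x))
    (hout : ∀ x, x ≠ l → x ≠ h → x ∉ J →
      F x ∨ x ∈ X ∨ (∃ e, ends e = s(x, l)) ∨ (∀ e, x ∉ ends e))
    (hcan : ∀ ξ, ∀ T ⊆ J, ∀ ζ ∈ gOutSide ends l h 𝓤 𝓓 𝓓'' X 𝓤' ({l}ᶜ) ξ,
      escSetE ends J ({l}ᶜ) ζ = T →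
        DecoCanonical ends (insert h (↑(J \ T) : Set V)) l ({l}ᶜ) (↑T) ζ) :
    GTypedSwAll ends l h 𝓤 𝓓 𝓓'' X 𝓤' := by
  refine exists_swAll_injection_of_card_le h _ (card_le_g_of_classes hlh fun ξ 𝓔 h𝓔 => ?_)
  refine rigidOK_g_of_junctions_deco (J := J) (F := F) h𝓤 h𝓓 h𝓓'' h𝓤' (by simp) hloop hF ?_ ?_
    hhX hJX ?_ h𝓔
  · intro x hx hxh hxJ
    rcases hout x (by simpa using hx) hxh hxJ with hf | hxX | ⟨e, he⟩ | hiso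
    · exact Or.inl hf
    · exact Or.inr (Or.inl hxX)
    · exact Or.inr (Or.inr (Or.inl ⟨e, l, he, by simp⟩))
    · exact Or.inr (Or.inr (Or.inr hiso))
  · intro x hx hxU
    exact hX x hx (by simpa using hxU)
  · intro T hT ζ hζ hesc
    exact hcan ξ T hT ζ hζ hesc

end Graph

section MarkStep

variable {x : V}

/-- **THE GENERAL MARK STEP WITH ANY SET OF JUNCTIONS, THE ESCAPES IN EITHER COLOUR**: row
2′SW-ALL with the mark `x` on every graph whose vertices other than `l, h, x` are joined to `l`,
hang on the mark, or belong to a set `J` of junctions (no loop at `h` or at a junction;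
`l, h, x ∉ J`), under the canonical conditions of the decorated cubes on every pattern of the
mark's edges (`isolate ends x` = the graph with the mark's edges turned into loops at the mark,
`markU ends d x` / `markD ends d x` / `markD'' ends d x` = the pattern's families). -/
theorem swAll_markStep_of_junctions_deco (hlh : l ≠ h) (hloop : ∀ e, ends e ≠ s(h, h))
    (hxl : x ≠ l) (hxh : x ≠ h) {J : Finset V} (hlJ : l ∉ J) (hhJ : h ∉ J) (hxJ : x ∉ J)
    (hloopJ : ∀ u ∈ J, ∀ e, ends e ≠ s(u, u))
    (hout : ∀ y, y ≠ l → y ≠ h → y ≠ x → y ∉ J →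
      (∃ e, ends e = s(y, l)) ∨ (∀ e, y ∈ ends e → x ∈ ends e))
    (hcan : ∀ d : Config E, ∀ ξ, ∀ T ⊆ J, ∀ ζ ∈ gOutSide (isolate ends x) l h (markU ends d x)
      (markD ends d x) (markD'' ends d x) {x} Set.univ ({l}ᶜ) ξ,
        escSetE (isolate ends x) J ({l}ᶜ) ζ = T →
          DecoCanonical (isolate ends x) (insert h (↑(J \ T) : Set V)) l ({l}ᶜ) (↑T) ζ) :
    SwAll ends l h x := by
  have _hlJ := hlJ
  have _hhJ := hhJ
  refine swAll_of_gTyped_patterns hxl hxh fun d _ => ?_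
  have hloop' : ∀ e r, r ∈ insert h (↑J : Set V) → ends e ≠ s(r, r) := by
    rintro e r (rfl | hr)
    · exact hloop e
    · exact hloopJ r hr e
  refine gTypedSwAll_of_junctions_deco
    (F := fun y => y ∈ openNbrs ends d x ∧ ∀ z ∈ openNbrs ends d x, z = y) (J := J)
    hlh (isolate_hloop_set hxh hxJ hloop') (isUpperSet_markU d x) (isLowerSet_markD d x)
    (isLowerSet_markD'' d x) isUpperSet_univ ?_ ?_ ?_ ?_ ?_ (hcan d)
  · -- the unique red neighbour is forced into `C_R(l)`
    rintro y ⟨-, huniq⟩ S ⟨z, hz, hzS⟩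
    rw [← huniq z hz]
    exact hzS
  · exact fun h' => hxh (Set.mem_singleton_iff.1 h').symm
  · intro u hu h'
    exact hxJ ((Set.mem_singleton_iff.1 h') ▸ hu)
  · intro y hy _ e hye
    rw [Set.mem_singleton_iff] at hy
    subst hy
    exact isolate_selfLoops e hye
  · intro y hyl hyh hyJ
    by_cases hyx : y = x
    · exact Or.inr (Or.inl (by rw [hyx]; exact Set.mem_singleton _))
    by_cases hyF : y ∈ openNbrs ends d x ∧ ∀ z ∈ openNbrs ends d x, z = y
    · exact Or.inl hyF
    rcases hout y hyl hyh hyx hyJ with ⟨e, he⟩ | hiso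
    · exact Or.inr (Or.inr (Or.inl ⟨e, isolate_eq_of_ends_eq hyx hxl.symm he⟩))
    · exact Or.inr (Or.inr (Or.inr (isolate_iso hyx hiso)))

/-- **Row (SW) from the general mark step with any set of junctions, the escapes in either
colour.** -/
theorem sw_markStep_of_junctions_deco (hlh : l ≠ h) (hloop : ∀ e, ends e ≠ s(h, h))
    (hxl : x ≠ l) (hxh : x ≠ h) {J : Finset V} (hlJ : l ∉ J) (hhJ : h ∉ J) (hxJ : x ∉ J)
    (hloopJ : ∀ u ∈ J, ∀ e, ends e ≠ s(u, u))
    (hout : ∀ y, y ≠ l → y ≠ h → y ≠ x → y ∉ J →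
      (∃ e, ends e = s(y, l)) ∨ (∀ e, y ∈ ends e → x ∈ ends e))
    (hcan : ∀ d : Config E, ∀ ξ, ∀ T ⊆ J, ∀ ζ ∈ gOutSide (isolate ends x) l h (markU ends d x)
      (markD ends d x) (markD'' ends d x) {x} Set.univ ({l}ᶜ) ξ,
        escSetE (isolate ends x) J ({l}ᶜ) ζ = T →
          DecoCanonical (isolate ends x) (insert h (↑(J \ T) : Set V)) l ({l}ᶜ) (↑T) ζ) :
    Sw ends l h x :=
  sw_of_swAll ends
    (swAll_markStep_of_junctions_deco hlh hloop hxl hxh hlJ hhJ hxJ hloopJ hout hcan)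

end MarkStep

end LocRows

end Summit.Ventures.PercRepro2
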